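import Mathlib
import HarnessLib
import Literature.Analysis.FluidPDE.TypeIAncientMild
import Summits.NavierStokesRegularity.NavierStokesRegularity.Theorems.PoloidalWindowDoorPoloidalWindowRigidityWindow
import Summits.NavierStokesRegularity.NavierStokesRegularity.Theorems.PoloidalWindowDoorPoloidalWindowRigidityHotLoopPrelim

/-!
# Route `PoloidalWindowDoor`, crux `PoloidalWindowRigidity` (K2, stmt-NavierStokesRegularity-19708) — STUB HP3′
# `stub_islandsPersist` of line `hot_loops` v3 (ns-idea-8 g6): ISLAND DATA PERSIST ON NEARBY PLANES AND TIMES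

Cell ns-regularity-ideate, seat ns-poloidal-K2-p2 g11 (stub-worker on K2; `--supports` the crux item).

* `stub_islandsPersist` — VERBATIM: for a profile of the route's Type-I class (only slab continuity is used), a time `s₀ < 0`,
  a plane `{y₂ = z₁}`, a sign `σ`, a level `M` and an admissible island datum `(K, O)` for `σ v₂(s₀,·)`, there is `δ > 0` such
  that every plane `{y₂ = z₀}`, `|z₀ − z₁| < δ`, at every time `|s − s₀| < δ` carries an admissible island datum `(M', K', O')`
  for the same `σ`: `K'` = maximisers of `σ v₂(s,·)` on the closed collar region `{y₂ = z₀, infDist(πy, K) ≤ ρ}` (`π` the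
  vertical projection onto `{y₂ = z₁}`), `O' = {infDist(π·, K) < ρ}`; maximisers stay off the rim by UNIFORM CONTINUITY of
  `(s,y) ↦ v s y` on a compact part of the slab (rim values at `(s₀, z₁)` are `≤ m < M`).  Same proof as the landed v2 stub
  `…HotLoopsNearbyIslands.stub_nearbyIslands` (base `(−1, 0)`), now at an arbitrary base `(s₀, z₁)`.

WHAT THIS IS NOT: not a claim about Navier–Stokes regularity — compactness/continuity bookkeeping for one provable stub of an
ideator line about HYPOTHETICAL class profiles (bears_on LADDER-NS N0, rung N0-LocalTubeDoorPoloidal).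
-/

noncomputable section

-- the summit and its single sub-problem share the name (CONVENTIONS §1), as in every Theorems file
set_option linter.dupNamespace false

namespace Summit.NavierStokesRegularity.NavierStokesRegularity.Theorems.PoloidalWindowDoorPoloidalWindowRigidityHotLoopsIslandsPersist

open MeasureTheory Set Function Filter Topology Metric
open scoped RealInnerProductSpace InnerProductSpace
open Literature.Analysis Literature.Analysis.FluidPDE
open Summit.NavierStokesRegularity.NavierStokesRegularity.Theorems.PoloidalWindowDoorPoloidalWindowRigidityWindow
open Summit.NavierStokesRegularity.NavierStokesRegularity.Theorems.PoloidalWindowDoorPoloidalWindowRigidityHotLoopPrelim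

/-- **STUB HP3′ `stub_islandsPersist` (VERBATIM, line `hot_loops` v3 of crux `PoloidalWindowRigidity`).** -/
theorem stub_islandsPersist :
    ∀ (C : ℝ) (v : ℝ → EuclideanSpace ℝ (Fin 3) → EuclideanSpace ℝ (Fin 3)),
      Literature.Analysis.FluidPDE.HasTypeITimeDecay C v →
      ContinuousOn (Function.uncurry v) (Set.Iio (0 : ℝ) ×ˢ Set.univ) →
      (∀ s t : ℝ, s < t → t < 0 → ∀ x, v t x =
        Literature.Analysis.UnboundedOperators.heatExtension (v s) (t - s) x -
          Literature.Analysis.FluidPDE.oseenDuhamel 1 s v v t x) →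
      (∀ t < 0, Literature.Analysis.FluidPDE.VectorCalculus.IsDivFree (v t)) →
      (∀ s < 0, ∀ y, ⟪Literature.Analysis.FluidPDE.curl (v s) y, EuclideanSpace.single 2 1⟫_ℝ = 0) →
      ∀ (s₀ z₁ σ M : ℝ) (K O : Set (EuclideanSpace ℝ (Fin 3))), s₀ < 0 →
        ((σ = 1 ∨ σ = -1) ∧ IsCompact K ∧ K.Nonempty ∧ (∀ y ∈ K, y 2 = z₁ ∧ σ * v s₀ y 2 = M) ∧
          IsOpen O ∧ K ⊆ O ∧ (∀ y ∈ O, y 2 = z₁ → σ * v s₀ y 2 ≤ M) ∧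
          (∀ y ∈ O, y 2 = z₁ → σ * v s₀ y 2 = M → y ∈ K)) →
        ∃ δ : ℝ, 0 < δ ∧ ∀ s z₀ : ℝ, |s - s₀| < δ → |z₀ - z₁| < δ →
          s < 0 ∧ ∃ (M' : ℝ) (K' O' : Set (EuclideanSpace ℝ (Fin 3))),
            ((σ = 1 ∨ σ = -1) ∧ IsCompact K' ∧ K'.Nonempty ∧ (∀ y ∈ K', y 2 = z₀ ∧ σ * v s y 2 = M') ∧
              IsOpen O' ∧ K' ⊆ O' ∧ (∀ y ∈ O', y 2 = z₀ → σ * v s y 2 ≤ M') ∧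
              (∀ y ∈ O', y 2 = z₀ → σ * v s y 2 = M' → y ∈ K')) := by
  intro C v hrate hcont hmild hdiv _hpol s₀ z₁ σ M K O hs₀ hdat
  obtain ⟨hσ1, hKc, hKne, hKM, hO, hKO, hle, hiso⟩ := hdat
  obtain ⟨k₀, hk₀⟩ := hKne
  have hk₀2 : k₀ 2 = z₁ := (hKM k₀ hk₀).1
  set e2 : EuclideanSpace ℝ (Fin 3) := EuclideanSpace.single 2 1 with he2
  -- the vertical projection onto `{y₂ = z₁}`
  set π : EuclideanSpace ℝ (Fin 3) → EuclideanSpace ℝ (Fin 3) := fun y => y - (y 2 - z₁) • e2 with hπ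
  have hπc : Continuous π := by
    have h2 : Continuous fun y : EuclideanSpace ℝ (Fin 3) => y 2 - z₁ :=
      (EuclideanSpace.proj (2 : Fin 3)).continuous.sub continuous_const
    exact continuous_id.sub (h2.smul continuous_const)
  have hπ2 : ∀ y, π y 2 = z₁ := fun y => by simp [hπ, he2]
  have hπdist : ∀ y, dist y (π y) = |y 2 - z₁| := fun y => by
    rw [dist_eq_norm, show y - π y = (y 2 - z₁) • e2 by rw [hπ]; dsimp only; abel, norm_smul, Real.norm_eq_abs]
    simp [he2]
  have hπ0 : ∀ y : EuclideanSpace ℝ (Fin 3), y 2 = z₁ → π y = y := fun y hy => by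
    simp only [hπ, hy, sub_self, zero_smul, sub_zero]
  -- `f = σ v₂(s₀,·)` on the plane: `≤ M` on `O`, `= M` only on `K`
  have hfhot : ∀ y ∈ O, y 2 = z₁ → σ * v s₀ y 2 = M → y ∈ K := hiso
  -- the scale `ρ` with `cthickening (2ρ) K ⊆ O`, a radius for `K`
  have hKne : K.Nonempty := ⟨k₀, hk₀⟩
  obtain ⟨δ₀, hδ₀, hδ₀O⟩ := hKc.exists_cthickening_subset_open hO hKO
  set ρ : ℝ := δ₀ / 2 with hρ
  have hρ0 : 0 < ρ := by positivity
  have hinO : ∀ y, infDist y K ≤ ρ → y ∈ O := fun y hy =>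
    hδ₀O (thickening_subset_cthickening δ₀ K ((mem_thickening_iff_infDist_lt hKne).2 (by rw [hρ] at hy; linarith)))
  obtain ⟨R₀, hKR⟩ := hKc.isBounded.subset_closedBall k₀
  have hR₀ : 0 ≤ R₀ := by have h := hKR hk₀; rw [mem_closedBall, dist_self] at h; exact h
  -- the rim `S = {y₂ = z₁, infDist = ρ}` and its bound `m < M`
  set S : Set (EuclideanSpace ℝ (Fin 3)) := {y | y 2 = z₁ ∧ infDist y K = ρ} with hS
  have hSclosed : IsClosed S := by
    rw [hS, setOf_and]
    exact (isClosed_eq (EuclideanSpace.proj (2 : Fin 3)).continuous continuous_const).inter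
      (isClosed_eq (continuous_infDist_pt K) continuous_const)
  have hSbdd : S ⊆ closedBall k₀ (R₀ + (ρ + 1)) := fun y hy =>
    mem_closedBall.2 (dist_lt_of_infDist_lt hKne hKR (by rw [hy.2]; linarith : infDist y K < ρ + 1)).le
  have hSc : IsCompact S := (isCompact_closedBall _ _).of_isClosed_subset hSclosed hSbdd
  have hSlt : ∀ y ∈ S, σ * v s₀ y 2 < M := by
    intro y hy
    refine lt_of_le_of_ne (hle y (hinO y hy.2.le) hy.1) fun h => ?_
    have hyK : y ∈ K := hfhot y (hinO y hy.2.le) hy.1 h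
    have := infDist_zero_of_mem hyK
    rw [hy.2] at this; linarith
  have hvc1 : Continuous (v s₀) :=
    (isTypeIAncientMild_of_class hrate hcont hmild hdiv).continuous_slice hs₀
  have hf1c : Continuous fun y => σ * v s₀ y 2 :=
    continuous_const.mul ((EuclideanSpace.proj (2 : Fin 3)).continuous.comp hvc1)
  obtain ⟨m, hmM, hSm⟩ : ∃ m : ℝ, m < M ∧ ∀ y ∈ S, σ * v s₀ y 2 ≤ m := by
    by_cases hSne : S.Nonempty
    · obtain ⟨a, haS, hamax⟩ := hSc.exists_isMaxOn hSne hf1c.continuousOn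
      exact ⟨σ * v s₀ a 2, hSlt a haS, fun y hy => hamax hy⟩
    · refine ⟨M - 1, by linarith, fun y hy => (hSne ⟨y, hy⟩).elim⟩
  set ε : ℝ := (M - m) / 3 with hε
  have hε0 : 0 < ε := by rw [hε]; linarith
  -- uniform continuity of `uncurry v` on a compact part of the slab
  set Cset : Set (ℝ × EuclideanSpace ℝ (Fin 3)) :=
    Icc (s₀ + s₀ / 2) (s₀ / 2) ×ˢ closedBall k₀ (R₀ + ρ + 2) with hCset
  have hCc : IsCompact Cset := (isCompact_Icc.prod (isCompact_closedBall _ _))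
  have hCsub : Cset ⊆ Iio (0 : ℝ) ×ˢ univ := fun p hp => ⟨by have := hp.1.2; simp only [mem_Iio]; linarith, trivial⟩
  have huc : UniformContinuousOn (uncurry v) Cset := hCc.uniformContinuousOn_of_continuous (hcont.mono hCsub)
  obtain ⟨δ₁, hδ₁, hδ₁uc⟩ := Metric.uniformContinuousOn_iff.1 huc ε hε0
  -- the final `δ`
  set δ : ℝ := min δ₁ (min (-s₀ / 2) 1) with hδ
  have hδpos : 0 < δ := lt_min hδ₁ (lt_min (by linarith) one_pos)
  have hδ1 : δ ≤ δ₁ := min_le_left _ _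
  have hδs : δ ≤ -s₀ / 2 := (min_le_right _ _).trans (min_le_left _ _)
  have hδone : δ ≤ 1 := (min_le_right _ _).trans (min_le_right _ _)
  refine ⟨δ, hδpos, fun s z₀ hs hz => ?_⟩
  have hs' := abs_lt.1 hs
  have hz' := abs_lt.1 hz
  have hs0 : s < 0 := by linarith
  refine ⟨hs0, ?_⟩
  -- the comparison estimate between `(s, y)` and `(s₀, π y)` on the collar region
  have hvs : Continuous (v s) := (isTypeIAncientMild_of_class hrate hcont hmild hdiv).continuous_slice hs0
  have hgc : Continuous fun y => σ * v s y 2 :=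
    continuous_const.mul ((EuclideanSpace.proj (2 : Fin 3)).continuous.comp hvs)
  have hest : ∀ y : EuclideanSpace ℝ (Fin 3), y 2 = z₀ → infDist (π y) K ≤ ρ →
      |σ * v s y 2 - σ * v s₀ (π y) 2| < ε := by
    intro y hy2 hyd
    have hπy : dist (π y) k₀ < R₀ + (ρ + 1) := dist_lt_of_infDist_lt hKne hKR (by linarith : infDist (π y) K < ρ + 1)
    have hyπ : dist y (π y) < δ := by rw [hπdist, hy2]; exact hz
    have hpC : ((s, y) : ℝ × EuclideanSpace ℝ (Fin 3)) ∈ Cset := by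
      refine ⟨⟨by linarith, by linarith⟩, mem_closedBall.2 ?_⟩
      linarith [dist_triangle y (π y) k₀]
    have hqC : ((s₀ : ℝ), π y) ∈ Cset := ⟨⟨by linarith, by linarith⟩, mem_closedBall.2 (by linarith)⟩
    have hd : dist ((s, y) : ℝ × EuclideanSpace ℝ (Fin 3)) ((s₀ : ℝ), π y) < δ₁ := by
      rw [Prod.dist_eq]
      refine max_lt ?_ ?_
      · show dist s s₀ < δ₁
        rw [Real.dist_eq]; exact lt_of_lt_of_le hs hδ1
      · show dist y (π y) < δ₁
        exact lt_of_lt_of_le hyπ hδ1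
    have h := hδ₁uc (s, y) hpC (s₀, π y) hqC hd
    rw [dist_eq_norm] at h
    have hcomp : |v s y 2 - v s₀ (π y) 2| ≤ ‖v s y - v s₀ (π y)‖ := by
      have := abs_real_inner_le_norm (v s y - v s₀ (π y)) (EuclideanSpace.single 2 (1 : ℝ))
      rw [EuclideanSpace.inner_single_right] at this
      simpa using this
    have hσabs : |σ| = 1 := by rcases hσ1 with h1 | h1 <;> simp [h1]
    calc |σ * v s y 2 - σ * v s₀ (π y) 2| = |σ| * |v s y 2 - v s₀ (π y) 2| := by
            rw [← mul_sub, abs_mul]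
      _ < ε := by rw [hσabs, one_mul]; exact lt_of_le_of_lt hcomp h
  -- the collar region `R'`, its maximum `M'`, the island `K'` and the open set `O'`
  set R' : Set (EuclideanSpace ℝ (Fin 3)) := {y | y 2 = z₀ ∧ infDist (π y) K ≤ ρ} with hR'
  have hR'closed : IsClosed R' := by
    rw [hR', setOf_and]
    exact (isClosed_eq (EuclideanSpace.proj (2 : Fin 3)).continuous continuous_const).inter
      (isClosed_le ((continuous_infDist_pt K).comp hπc) continuous_const)
  have hR'bdd : R' ⊆ closedBall k₀ (R₀ + ρ + 2) := by
    intro y hy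
    have hπy : dist (π y) k₀ < R₀ + (ρ + 1) := dist_lt_of_infDist_lt hKne hKR (by linarith [hy.2] : infDist (π y) K < ρ + 1)
    have hyπ : dist y (π y) < 1 := by rw [hπdist, hy.1]; exact lt_of_lt_of_le hz hδone
    exact mem_closedBall.2 (by linarith [dist_triangle y (π y) k₀])
  have hR'c : IsCompact R' := (isCompact_closedBall _ _).of_isClosed_subset hR'closed hR'bdd
  set b : EuclideanSpace ℝ (Fin 3) := k₀ + (z₀ - z₁) • e2 with hb
  have hb2 : b 2 = z₀ := by simp [hb, he2, hk₀2]
  have hπb : π b = k₀ := by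
    rw [show π b = b - (b 2 - z₁) • e2 from rfl, hb2, hb, add_sub_cancel_right]
  have hbR' : b ∈ R' := ⟨hb2, by rw [hπb, infDist_zero_of_mem hk₀]; exact hρ0.le⟩
  obtain ⟨a, haR', hamax⟩ := hR'c.exists_isMaxOn ⟨b, hbR'⟩ hgc.continuousOn
  set M' : ℝ := σ * v s a 2 with hM'
  have hR'le : ∀ y ∈ R', σ * v s y 2 ≤ M' := fun y hy => hamax hy
  set K' : Set (EuclideanSpace ℝ (Fin 3)) := R' ∩ {y | σ * v s y 2 = M'} with hK'
  set O' : Set (EuclideanSpace ℝ (Fin 3)) := {y | infDist (π y) K < ρ} with hO'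
  have hK'c : IsCompact K' := hR'c.inter_right (isClosed_eq hgc continuous_const)
  have hO'open : IsOpen O' := isOpen_lt ((continuous_infDist_pt K).comp hπc) continuous_const
  -- the value above the hot piece beats every rim value
  have hMb : M - ε < M' := by
    have h1 := hest b hb2 (by rw [hπb, infDist_zero_of_mem hk₀]; exact hρ0.le)
    rw [hπb, (hKM k₀ hk₀).2] at h1
    have h2 := (abs_lt.1 h1).1
    linarith [hR'le b hbR']
  have hK'O' : K' ⊆ O' := by
    intro y hy
    obtain ⟨⟨hy2, hyd⟩, hyM⟩ := hy
    refine lt_of_le_of_ne hyd fun heq => ?_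
    have hπS : π y ∈ S := ⟨hπ2 y, heq⟩
    have h1 := hest y hy2 hyd
    have h2 := (abs_lt.1 h1).2
    have h3 := hSm (π y) hπS
    have h4 : σ * v s y 2 = M' := hyM
    rw [hε] at h2 hMb
    linarith
  refine ⟨M', K', O', hσ1, hK'c, ⟨a, haR', rfl⟩, fun y hy => ⟨hy.1.1, hy.2⟩, hO'open, hK'O',
    fun y hy hy2 => hR'le y ⟨hy2, le_of_lt hy⟩, fun y hy hy2 hyM => ⟨⟨hy2, le_of_lt hy⟩, hyM⟩⟩

end Summit.NavierStokesRegularity.NavierStokesRegularity.Theorems.PoloidalWindowDoorPoloidalWindowRigidityHotLoopsIslandsPersist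

end
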